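import Summits.BirchSwinnertonDyer.Rank1Residual.Ordinary.Conjectures.KuriharaExactOrderFromPoitouTate
import Summits.BirchSwinnertonDyer.Rank1Residual.Ordinary.PointDivisibilityFormalLevel
import Literature.NumberTheory.EllipticCurves.SelmerLocalConditionGoodReductionProofs
import HarnessLib

/-!
# LAW-2 at `(ℓ, k)` for ANY odd good non-anomalous `p` and ANY local index `m_p`, in the DERIVED regime, from
# the Kolyvagin class + Kim's reading alone (theorems only — no named fact minted, no `sorry`; the law stays a
# CONJECTURE / structure datum; nothing about any curve's BSD)

HONEST FRAMING (cell `b2b-bsdres`, run/shared/lean/b2b/bsd-rank1-residual/, verbatim in every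
file): the goal of the cell is to DELETE the COMBINATION-SHAPED residual classes of the
Birch–Swinnerton-Dyer formula for ALL analytic-rank `≤ 1` elliptic curves over `ℚ` — "full BSD
formula for every rank `≤ 1` curve in class `C`" assembled STRICTLY from published theorems — so
that the rank-`≤ 1` remainder becomes exactly the CONSTRUCTION-SHAPED classes, which are TYPED
(missing-input `Prop`s), NOT attempted. This is not "finishing BSD". Seat `b2b-bsdres-additive-p3`
(X8 prover B / X7 joint; typer-designate for the cell conjecture C-16 = hyp C120.1 by hyp R-16 (e)).
This file books nothing and moves no mark; X7 / X8 stay CONSTRUCTION-SHAPED; the rank-one depth law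
(`R1-DEPTH-LAW.md`; C-16 / C-17 at `p = 3`) stays a CONJECTURE.

## What this file does

`Conjectures/KuriharaExactOrderFromPoitouTate.lean` treats C-16's letter (`p = 3`, `m₃(P) = 0`). The same kernel
chain runs for EVERY odd good non-anomalous `p` and EVERY local index `m = m_p(P)` (read on the formal group:
`#Ẽ(𝔽_p)·P ∈ E⁽ᵐ⁺¹⁾(ℚ_p) ∖ E⁽ᵐ⁺²⁾(ℚ_p)`, `Ordinary/LocalClassOrders.lean` §3), in the DERIVED REGIME of
`R1-DEPTH-LAW.md` §2 ("DERIVED when `m_p = 0` or `FLOOR + m_p + 2v < k′`"):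

* §1 `exists_not_exists_p_smul_eq`: at an odd good non-anomalous `p` there is a point of `E(ℚ_p)` that is NOT
  `p`-divisible (a point of formal level exactly `1`: `E⁽¹⁾ ≅ ℤ_p`, `E⁽²⁾ = p·E⁽¹⁾`, AEC IV.6.4 (b)), hence
  (`LocalPointsIdentification`) an identification `E(ℚ_p) ↠ ℤ/p^n` with kernel `p^n·E(ℚ_p)` EXISTS
  (`exists_pointIdentification_padic`);
* §2 `exists_min_eq_min_of_kolyvaginClass`: `W` minimal, `p` odd good with `p ∤ #Ẽ(𝔽_p)`, `ℓ` with cyclic `p`-torsion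
  mod `ℓ`, `P ∈ E(ℚ)` with formal-level datum `m`, places `vℓ ∋ ℓ`, `v_p ∋ p`, the two NAMED FACTS (Poitou–Tate over
  `ℚ`; Tate's local Euler characteristic at `ℚ_ℓ`, `ℚ_p`) displayed as hypotheses; GIVEN a depth `n ≥ 1` with
  `ℓ ∈ 𝒫_n`, `u` with `p ∤ u`, a class `x ∈ H¹(ℚ, E[p^n])` Kummer outside `{vℓ, v_p}` with
  `[loc_ℓ x] = θ[loc_ℓ κ((p^{m+F}·u)·P)]` for SOME additive isomorphism `θ : 𝓛_ℓ ≅ H¹(ℚ_ℓ, E[p^n]) ⧸ 𝓛_ℓ` (the Kolyvagin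
  class with its KS relation to `κ₁ = p^a u·κ(P)`, `a = m_p + FLOOR` — Kato + Mazur–Rubin 3.2.4 / 5.2.12, the
  arithmetic side of 5.2.12 being `Ordinary/StrictSelmerIndexRankOneRat.lean`): **`min(n, m + F + 2v_ℓ(P)) =
  min(n, ord_p ψ_p[loc_p x] + m)`** for an identification `ψ_p` of the singular quotient at `p` (= §2 (iii)'s
  displayed equation, `s = ord loc^s_p x`); then with Kim's reading `ord_p(δ̃_ℓ mod p^k) = min(k, ord_p ψ_p[loc_p x])`
  (every `ψ_p`; `k ≤ n`): **`zmodPowOrd_kuriharaNumber_eq_of_kolyvaginClass`** — in the regime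
  `m = 0 ∨ m + F + 2v_ℓ(P) < n`, **`ord_p(δ̃_ℓ mod p^k) = min(k, F + 2·v_ℓ(P))`** (LAW-2 at `(ℓ, k)`) — and
  `min_le_zmodPowOrd_kuriharaNumber_of_kolyvaginClass` — for `n ≤ m + F + 2v_ℓ(P)`, only
  `min(k, n − m) ≤ ord_p(δ̃_ℓ mod p^k)` ("ord ≥ k′ − m_p");
* §3 (any number field, any `n`): at a good finite place `v ∤ n` the Kummer condition IS the unramified condition
  (`localization_mem_kummerSelmerStructure_iff_mem_unramifiedKer`, the tree's `selmerLocalKer_eq_unramifiedKer`), so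
  for odd `n` «unramified at the good places off `S`, Kummer at the others» gives `x ∈ kummerOutside W n S`
  (`mem_kummerOutside_of_unramified_of_odd`) — the hypothesis of §2 in the language of a Kolyvagin system for
  `(E[p^k], 𝓕_can, 𝒫)` (Mazur–Rubin Def. 3.2.1).

So for the `p ≥ 5` lane (x10b; Kim 2022 printed for `p ≥ 5`) and for C-17's `m₃ ≥ 1` letter inside the derived
regime, the per-level input is exactly the Kolyvagin-system class and Kim's Thm. 3.13 — reciprocity, local
dualities, identifications, the three local orders and the count are kernel theorems (modulo the two published
facts). Outside the derived regime the skeleton only bounds (`Ordinary.singularOrder_dichotomy`), as recorded.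

References: `R1-DEPTH-LAW.md` §1–§2; B. Mazur, K. Rubin, Mem. AMS 799 (2004), Thm. 3.2.4, Thm. 5.2.12
[MazurRubin2004]; C.-H. Kim, arXiv:2203.12159, Thm. 3.13, (5.3) [Kim2022StructureSelmer]; J. S. Milne, ADT (2006),
I 2.3, 2.8, 4.10(b) [MilneADT2006]; J. H. Silverman, AEC (2009), IV.6.4 (b), VII.2.1 [SilvermanAEC2009].
-/

noncomputable section

open scoped Classical MatrixGroups ModularForm

open CongruenceSubgroup WeierstrassCurve Literature.NumberTheory.EllipticCurves
  Literature.NumberTheory.EllipticCurves.ModularForms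
  Literature.NumberTheory.EllipticCurves.Rank1Residual
  Literature.NumberTheory.GaloisRepresentations Literature.NumberTheory.GaloisCohomology
  Function NumberField IsDedekindDomain

namespace Summit.BirchSwinnertonDyer.Rank1Residual.Ordinary

/-! ### §1 A non-`p`-divisible point of `E(ℚ_p)`; existence of the `p`-side identification -/

section Padic

variable (W : WeierstrassCurve ℚ) [W.IsElliptic] [W.IsGloballyMinimal] (p : ℕ) [hp : Fact p.Prime]

/-- **At an odd good non-anomalous `p`, `E(ℚ_p)` has a point that is not `p`-divisible**: a point `Y` of formal
level exactly `1` (`E⁽¹⁾(ℚ_p) ≅ ℤ_p`, `Y ↦ 1`; `Y ∈ E⁽²⁾ = p·E⁽¹⁾` would make `1 ∈ pℤ_p`); `Y ∈ p·E(ℚ_p)` iff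
`#Ẽ(𝔽_p)·Y ∈ E⁽²⁾` (`PointDivisibilityFormalLevel`), which fails since `p ∤ #Ẽ(𝔽_p)`
(`nsmul_not_mem_formalFiltration_two`). [cite: SilvermanAEC2009, IV.6.4 (b) and VII.2.1] -/
theorem exists_not_exists_p_smul_eq (hp2 : p ≠ 2) (hgood : ¬ (p : ℤ) ∣ minimalDiscriminantInt W)
    (hna : ¬ p ∣ W.reductionPointCount p) :
    ∃ Y : (W.baseChange ℚ_[p]).toAffine.Point, ¬ ∃ Q : (W.baseChange ℚ_[p]).toAffine.Point, p • Q = Y := by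
  set V := W.baseChange ℚ_[p] with hV
  obtain ⟨e⟩ := nonempty_formalFiltration_one_addEquiv_padicInt V hp2
  set Y : V.formalFiltration 1 := e.symm 1 with hY
  have hY1 : (Y : V.toAffine.Point) ∈ V.formalFiltration 1 := Y.2
  have hY2 : (Y : V.toAffine.Point) ∉ V.formalFiltration 2 := by
    intro h2
    obtain ⟨Q, hQ, hQY⟩ := exists_p_nsmul_eq_of_mem_formalFiltration_succ V hp2 le_rfl h2
    have hQY' : p • (⟨Q, hQ⟩ : V.formalFiltration 1) = Y := Subtype.ext hQY
    have h1 : (p : ℤ_[p]) * e ⟨Q, hQ⟩ = 1 := by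
      rw [← nsmul_eq_mul, ← map_nsmul, hQY', hY, AddEquiv.apply_symm_apply]
    exact (PadicInt.irreducible_p (p := p)).not_isUnit (IsUnit.of_mul_eq_one _ h1)
  refine ⟨Y, fun hdiv => ?_⟩
  have hmem : W.reductionPointCount p • (Y : V.toAffine.Point) ∈ V.formalFiltration 2 :=
    (exists_pow_smul_eq_iff_reductionPointCount_nsmul_mem_formalFiltration W p hp2 hgood hna _ 1).mp
      (by simpa only [pow_one] using hdiv)
  exact nsmul_not_mem_formalFiltration_two V hna hY1 hY2 hmem

/-- Hence an identification **`φ : E(ℚ_p) ↠ ℤ/p^n` with kernel `p^n·E(ℚ_p)`** exists at every odd good non-anomalous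
`p`, for every `n` (`LocalPointsIdentification.exists_addMonoidHom_zmod_pow_of_not_exists_p_smul_eq` at the point
of §1). [cite: SilvermanAEC2009, IV.6.4 (b) and VII.6.3] -/
theorem exists_pointIdentification_padic (hp2 : p ≠ 2) (hgood : ¬ (p : ℤ) ∣ minimalDiscriminantInt W)
    (hna : ¬ p ∣ W.reductionPointCount p) (n : ℕ) :
    ∃ φ : (W.baseChange ℚ_[p]).toAffine.Point →+ ZMod (p ^ n),
      Surjective φ ∧ ∀ g, φ g = 0 ↔ ∃ h, p ^ n • h = g := by
  obtain ⟨Y, hY⟩ := exists_not_exists_p_smul_eq W p hp2 hgood hna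
  obtain ⟨φ, hφ, hker, -⟩ := exists_addMonoidHom_zmod_pow_of_not_exists_p_smul_eq W p hp2 hgood hna hY n
  exact ⟨φ, hφ, hker⟩

end Padic

/-! ### §2 LAW-2 at `(ℓ, k)` in the derived regime from the Kolyvagin class + Kim's reading -/

section Law

variable (W : WeierstrassCurve ℚ) [W.IsElliptic] [W.IsGloballyMinimal] {N : ℕ} (f : CuspForm (Gamma0 N) 2)
  (p ℓ : ℕ) [hp : Fact p.Prime] [Fact ℓ.Prime] (k : ℕ) (P : W.toAffine.Point) (F m : ℕ)

/-- **The skeleton's equation `min(n, m + F + 2v) = min(n, s + m)` for a Kolyvagin-type class, ANY odd good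
non-anomalous `p`, ANY `m = m_p(P)`** (no regime, no reading of `δ̃`). Setting: `W` globally minimal; `p` odd,
`p ∤ Δ_min`, `p ∤ #Ẽ(𝔽_p)`; the formal-level datum of `P` at `p` (`#Ẽ(𝔽_p)·P_p ∈ E⁽ᵐ⁺¹⁾ ∖ E⁽ᵐ⁺²⁾`); `ℓ` with cyclic
`p`-torsion mod `ℓ`; places `vℓ ∋ ℓ`, `v_p ∋ p`; the two NAMED FACTS displayed. Data: a depth `n ≥ 1` with
`ℓ ∈ 𝒫_n(W, p)`; `u`, `p ∤ u`; a class `x ∈ H¹(ℚ, E[p^n])` Kummer outside `{vℓ, v_p}`; an additive isomorphism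
`θ : 𝓛_{vℓ} ≅ H¹(ℚ_{vℓ}, E[p^n]) ⧸ 𝓛_{vℓ}` with `[loc_{vℓ} x] = θ[loc_{vℓ} κ((p^{m+F}·u)·P)]` (the KS relation, `a = m + F`).
Conclusion: for some identification `ψ_p` of the singular quotient at `p` (all give the same order),
`min(n, m + F + 2·v_ℓ(P)) = min(n, ord_p ψ_p[loc_p x] + m)`. Proof: identifications `φ_ℓ` (`CyclicSylowQuotient`) and
`φ_p` (§1), Kummer side (`ReciprocityPT` ports); `ReciprocityPT.exists_singular_identification_min_eq_min_of_facts` with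
the local orders of `LocalClassOrders` (`min(n, m + F + v)`, `min(n, v)`, `min(n, m)`).
[cite: MazurRubin2004, Thm. 3.2.4 and Thm. 5.2.12] [cite: MilneADT2006, Ch. I, Thm. 4.10(b), Cor. 2.3, Thm. 2.8] -/
theorem exists_min_eq_min_of_kolyvaginClass (hp2 : p ≠ 2)
    (hgood : ¬ (p : ℤ) ∣ minimalDiscriminantInt W) (hna : ¬ p ∣ W.reductionPointCount p)
    (hm1 : W.reductionPointCount p • Affine.Point.map (W' := W.toAffine) (Algebra.ofId ℚ ℚ_[p]) P ∈
      (W.baseChange ℚ_[p]).formalFiltration (m + 1))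
    (hm2 : W.reductionPointCount p • Affine.Point.map (W' := W.toAffine) (Algebra.ofId ℚ ℚ_[p]) P ∉
      (W.baseChange ℚ_[p]).formalFiltration (m + 2))
    (hcycℓ : IsCyclicKolyvaginLevel W p ℓ)
    {vℓ vp : HeightOneSpectrum (𝓞 ℚ)} (hvℓ : (ℓ : 𝓞 ℚ) ∈ vℓ.asIdeal) (hvp : (p : 𝓞 ℚ) ∈ vp.asIdeal)
    (hPT : poitouTate_sum_localTatePairing_eq_zero ℚ)
    (hEPℓ : localEulerPoincareCharacteristic (vℓ.adicCompletion ℚ))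
    (hEPp : localEulerPoincareCharacteristic (vp.adicCompletion ℚ))
    {n : ℕ} (hnpos : 0 < n) (hKP : Kato.IsKolyvaginPrime W p n ℓ) {u : ℕ} (hu : ¬ p ∣ u)
    {x : galoisCohomology (W.torsionGaloisModule ((p ^ n : ℕ) : ℤ)) 1}
    (hx : x ∈ kummerOutside W (p ^ n) {Sum.inr vℓ, Sum.inr vp})
    (θ : W.kummerSelmerStructure ((p ^ n : ℕ) : ℤ) (Sum.inr vℓ) ≃+
      galoisCohomology ((W.torsionGaloisModule (p ^ n : ℕ)).toLocal (Sum.inr vℓ)) 1 ⧸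
        W.kummerSelmerStructure ((p ^ n : ℕ) : ℤ) (Sum.inr vℓ))
    (hKS : (galoisCohomology.localization (W.torsionGaloisModule (p ^ n : ℕ)) (Sum.inr vℓ) 1 x :
        galoisCohomology ((W.torsionGaloisModule (p ^ n : ℕ)).toLocal (Sum.inr vℓ)) 1 ⧸
          W.kummerSelmerStructure ((p ^ n : ℕ) : ℤ) (Sum.inr vℓ)) =
      θ ⟨_, X11b.Relaxation.localization_kummerMapTorsion_mem W (p ^ n) (Sum.inr vℓ) ((p ^ (m + F) * u) • P)⟩) :
    ∃ ψ𝔭 : galoisCohomology ((W.torsionGaloisModule (p ^ n : ℕ)).toLocal (Sum.inr vp)) 1 ⧸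
        W.kummerSelmerStructure ((p ^ n : ℕ) : ℤ) (Sum.inr vp) ≃+ ZMod (p ^ n),
      min n (m + F + 2 * localDivExponent W p ℓ P) =
        min n (zmodPowOrd p n
          (ψ𝔭 (galoisCohomology.localization (W.torsionGaloisModule (p ^ n : ℕ)) (Sum.inr vp) 1 x)) + m) := by
  have hcyc : Nat.card {c : (((integralModelInt W).map (Int.castRingHom ℤ_[ℓ])).map
      (IsLocalRing.residue ℤ_[ℓ])).toAffine.Point // p • c = 0} ≤ p := by
    rw [natCard_torsion_residue_eq_natCard_torsion_zmod W ℓ p]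
    exact hcycℓ.2 ℓ dvd_rfl
  -- `ℓ ∈ 𝒫_n`: `ℓ ≠ p`, `ℓ` good, `n ≤ e_ℓ`
  have hℓp : ℓ ≠ p := hKP.ne
  have hgoodℓ' : W.HasGoodReductionAtPrime ℓ := by
    by_contra hbad
    exact hKP.not_dvd_conductorNorm ((W.dvd_conductorNorm_iff_not_hasGoodReductionAtPrime ℓ).mpr hbad)
  have hgoodℓ : ¬ (ℓ : ℤ) ∣ minimalDiscriminantInt W :=
    not_dvd_minimalDiscriminantInt_of_hasGoodReductionAtPrime' W ℓ hgoodℓ'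
  have hn : n ≤ padicValNat p (W.reductionPointCount ℓ) :=
    (padicValNat_dvd_iff_le (reductionPointCount_ne_zero W ℓ)).mp hKP.pow_dvd_reductionPointCount
  -- identifications of the Kummer conditions at `vℓ` and `vp`
  obtain ⟨φl, hφl, hkerl⟩ := exists_addMonoidHom_zmod_pow_reduction W p ℓ hcyc hn
  obtain ⟨φp, hφp, hkerp⟩ := exists_pointIdentification_padic W p hp2 hgood hna n
  have hq : ¬ ℓ ∣ p ^ n := fun hd =>
    hℓp ((Nat.prime_dvd_prime_iff_eq (Fact.out) hp.out).mp ((Fact.out : ℓ.Prime).dvd_of_dvd_pow hd))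
  obtain ⟨φL₁, hφL₁⟩ :=
    ReciprocityPT.exists_kummerIdentification_of_reduction W hvℓ hgoodℓ hq φl hφl hkerl
  obtain ⟨φL₂, hφL₂⟩ := ReciprocityPT.exists_kummerIdentification_of_padic W hvp φp hφp hkerp
  have hne : vℓ ≠ vp :=
    ReciprocityPT.ne_of_natCast_mem_asIdeal ((Nat.coprime_primes (Fact.out) hp.out).mpr hℓp) hvℓ hvp
  -- step (iii) from Poitou–Tate
  obtain ⟨ψ𝔭, H⟩ := ReciprocityPT.exists_singular_identification_min_eq_min_of_facts W p n hnpos hPT hne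
    hEPℓ hEPp φL₁ φL₂
  -- the three local orders (`LocalClassOrders`)
  have hxl : zmodPowOrd p n
      (φL₁ ⟨_, X11b.Relaxation.localization_kummerMapTorsion_mem W (p ^ n) (Sum.inr vℓ)
        ((p ^ (m + F) * u) • P)⟩) = min n ((m + F) + localDivExponent W p ℓ P) := by
    rw [hφL₁]
    exact zmodPowOrd_map_pow_mul_smul_reduction_eq W p ℓ hgoodℓ hℓp hcyc hn φl hφl hkerl P (m + F) hu
  have hyl : zmodPowOrd p n
      (φL₁ ⟨_, X11b.Relaxation.localization_kummerMapTorsion_mem W (p ^ n) (Sum.inr vℓ) P⟩) =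
        min n (localDivExponent W p ℓ P) := by
    have h1 := hφL₁ 1 P
    simp only [one_nsmul] at h1
    rw [h1]
    exact zmodPowOrd_map_reduction_eq W p ℓ hgoodℓ hℓp hcyc hn φl hφl hkerl P
  have hyp : zmodPowOrd p n
      (φL₂ ⟨_, X11b.Relaxation.localization_kummerMapTorsion_mem W (p ^ n) (Sum.inr vp) P⟩) = min n m := by
    rw [hφL₂]
    exact zmodPowOrd_map_point_eq W p hp2 hgood hna hm1 hm2 φp hφp hkerp
  exact ⟨ψ𝔭, H x hx P θ _ hKS hxl hyl hyp⟩

/-- **LAW-2 at `(ℓ, k)` — `ord_p(δ̃_ℓ mod p^k) = min(k, FLOOR + 2·v_ℓ(P))` — for ANY odd good non-anomalous `p` and ANY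
local index `m = m_p(P)`, in the DERIVED regime, from the KOLYVAGIN CLASS and KIM's READING alone** (the two named
facts displayed as hypotheses; setting of `exists_min_eq_min_of_kolyvaginClass`). For a surjective `ψ` at level `p^k`,
the data: a depth `n ≥ k` with `ℓ ∈ 𝒫_n(W, p)`; `u`, `p ∤ u`; a class `x ∈ H¹(ℚ, E[p^n])` Kummer outside `{vℓ, v_p}`;
an additive isomorphism `θ : 𝓛_{vℓ} ≅ H¹(ℚ_{vℓ}, E[p^n]) ⧸ 𝓛_{vℓ}` with `[loc_{vℓ} x] = θ[loc_{vℓ} κ((p^{m+F}·u)·P)]` (KS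
relation with `a = m + F`); the regime `m = 0 ∨ m + F + 2v_ℓ(P) < n` (`R1-DEPTH-LAW.md` §2: "DERIVED when `m_p = 0` or
`FLOOR + m_p + 2v < k′`"); Kim's reading for every identification `ψ_p`. So for the `p ≥ 5` lane and C-17's
`m₃ ≥ 1` letter inside the derived regime the per-level input is exactly the Kolyvagin class and Kim's Thm. 3.13.
[cite: MazurRubin2004, Thm. 3.2.4 and Thm. 5.2.12] [cite: Kim2022StructureSelmer, Thm. 3.13 and (5.3)]
[cite: MilneADT2006, Ch. I, Thm. 4.10(b), Cor. 2.3, Thm. 2.8] -/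
theorem zmodPowOrd_kuriharaNumber_eq_of_kolyvaginClass (hp2 : p ≠ 2)
    (hgood : ¬ (p : ℤ) ∣ minimalDiscriminantInt W) (hna : ¬ p ∣ W.reductionPointCount p)
    (hm1 : W.reductionPointCount p • Affine.Point.map (W' := W.toAffine) (Algebra.ofId ℚ ℚ_[p]) P ∈
      (W.baseChange ℚ_[p]).formalFiltration (m + 1))
    (hm2 : W.reductionPointCount p • Affine.Point.map (W' := W.toAffine) (Algebra.ofId ℚ ℚ_[p]) P ∉
      (W.baseChange ℚ_[p]).formalFiltration (m + 2))
    (hcycℓ : IsCyclicKolyvaginLevel W p ℓ)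
    {vℓ vp : HeightOneSpectrum (𝓞 ℚ)} (hvℓ : (ℓ : 𝓞 ℚ) ∈ vℓ.asIdeal) (hvp : (p : 𝓞 ℚ) ∈ vp.asIdeal)
    (hPT : poitouTate_sum_localTatePairing_eq_zero ℚ)
    (hEPℓ : localEulerPoincareCharacteristic (vℓ.adicCompletion ℚ))
    (hEPp : localEulerPoincareCharacteristic (vp.adicCompletion ℚ))
    (ψ : (q : ℕ) → (ZMod q)ˣ →* Multiplicative (ZMod (p ^ k)))
    (h : ∃ (n : ℕ) (_ : k ≤ n) (_ : Kato.IsKolyvaginPrime W p n ℓ) (u : ℕ) (_ : ¬ p ∣ u)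
        (x : galoisCohomology (W.torsionGaloisModule ((p ^ n : ℕ) : ℤ)) 1)
        (_ : x ∈ kummerOutside W (p ^ n) {Sum.inr vℓ, Sum.inr vp})
        (θ : W.kummerSelmerStructure ((p ^ n : ℕ) : ℤ) (Sum.inr vℓ) ≃+
          galoisCohomology ((W.torsionGaloisModule (p ^ n : ℕ)).toLocal (Sum.inr vℓ)) 1 ⧸
            W.kummerSelmerStructure ((p ^ n : ℕ) : ℤ) (Sum.inr vℓ)),
        (galoisCohomology.localization (W.torsionGaloisModule (p ^ n : ℕ)) (Sum.inr vℓ) 1 x :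
            galoisCohomology ((W.torsionGaloisModule (p ^ n : ℕ)).toLocal (Sum.inr vℓ)) 1 ⧸
              W.kummerSelmerStructure ((p ^ n : ℕ) : ℤ) (Sum.inr vℓ)) =
          θ ⟨_, X11b.Relaxation.localization_kummerMapTorsion_mem W (p ^ n) (Sum.inr vℓ)
            ((p ^ (m + F) * u) • P)⟩ ∧
        (m = 0 ∨ m + F + 2 * localDivExponent W p ℓ P < n) ∧
        ∀ ψp : galoisCohomology ((W.torsionGaloisModule (p ^ n : ℕ)).toLocal (Sum.inr vp)) 1 ⧸
            W.kummerSelmerStructure ((p ^ n : ℕ) : ℤ) (Sum.inr vp) ≃+ ZMod (p ^ n),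
          (haveI : NeZero ℓ := ⟨(Fact.out : ℓ.Prime).ne_zero⟩
           zmodPowOrd p k (kuriharaNumber f (p ^ k) ℓ ψ)) =
            min k (zmodPowOrd p n
              (ψp (galoisCohomology.localization (W.torsionGaloisModule (p ^ n : ℕ)) (Sum.inr vp) 1 x)))) :
    (haveI : NeZero ℓ := ⟨(Fact.out : ℓ.Prime).ne_zero⟩
     zmodPowOrd p k (kuriharaNumber f (p ^ k) ℓ ψ)) = min k (F + 2 * localDivExponent W p ℓ P) := by
  haveI : NeZero ℓ := ⟨(Fact.out : ℓ.Prime).ne_zero⟩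
  obtain ⟨n, hk, hKP, u, hu, x, hx, θ, hKS, hreg, hkim⟩ := h
  -- depth `0`: nothing to prove
  rcases Nat.eq_zero_or_pos n with hn0 | hnpos
  · subst hn0
    obtain rfl : k = 0 := Nat.le_zero.mp hk
    have h0 := zmodPowOrd_le hp.out (n := 0) (kuriharaNumber f (p ^ 0) ℓ ψ)
    omega
  obtain ⟨ψ𝔭, hmin⟩ := exists_min_eq_min_of_kolyvaginClass W p ℓ P F m hp2 hgood hna hm1 hm2 hcycℓ hvℓ hvp
    hPT hEPℓ hEPp hnpos hKP hu hx θ hKS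
  rw [hkim ψ𝔭]
  -- the derived regime: `m = 0 ∨ m + F + 2v < n`, and `k ≤ n`
  generalize zmodPowOrd p n (ψ𝔭 (galoisCohomology.localization (W.torsionGaloisModule (p ^ n : ℕ))
    (Sum.inr vp) 1 x)) = s at hmin ⊢
  generalize localDivExponent W p ℓ P = v at hmin hreg ⊢
  rcases hreg with hm0 | hlt
  · subst hm0; omega
  · omega

/-- **Outside the derived regime the derivation only BOUNDS** (`R1-DEPTH-LAW.md` §2: "outside that regime the derivation
gives `ord ≥ k′ − m_p` only"; the skeleton's `Ordinary.singularOrder_dichotomy`, now with (iii) discharged): with the data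
of `zmodPowOrd_kuriharaNumber_eq_of_kolyvaginClass` but `n ≤ m + F + 2v_ℓ(P)` instead of the regime,
`min(k, n − m) ≤ ord_p(δ̃_ℓ mod p^k)`. (Whether the free form still holds there is what P-5 ROUND 10 (C) read: `74/74`.)
[cite: MazurRubin2004, Thm. 5.2.12] [cite: Kim2022StructureSelmer, Thm. 3.13 and (5.3)] -/
theorem min_le_zmodPowOrd_kuriharaNumber_of_kolyvaginClass (hp2 : p ≠ 2)
    (hgood : ¬ (p : ℤ) ∣ minimalDiscriminantInt W) (hna : ¬ p ∣ W.reductionPointCount p)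
    (hm1 : W.reductionPointCount p • Affine.Point.map (W' := W.toAffine) (Algebra.ofId ℚ ℚ_[p]) P ∈
      (W.baseChange ℚ_[p]).formalFiltration (m + 1))
    (hm2 : W.reductionPointCount p • Affine.Point.map (W' := W.toAffine) (Algebra.ofId ℚ ℚ_[p]) P ∉
      (W.baseChange ℚ_[p]).formalFiltration (m + 2))
    (hcycℓ : IsCyclicKolyvaginLevel W p ℓ)
    {vℓ vp : HeightOneSpectrum (𝓞 ℚ)} (hvℓ : (ℓ : 𝓞 ℚ) ∈ vℓ.asIdeal) (hvp : (p : 𝓞 ℚ) ∈ vp.asIdeal)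
    (hPT : poitouTate_sum_localTatePairing_eq_zero ℚ)
    (hEPℓ : localEulerPoincareCharacteristic (vℓ.adicCompletion ℚ))
    (hEPp : localEulerPoincareCharacteristic (vp.adicCompletion ℚ))
    (ψ : (q : ℕ) → (ZMod q)ˣ →* Multiplicative (ZMod (p ^ k)))
    {n : ℕ} (hk : k ≤ n) (hKP : Kato.IsKolyvaginPrime W p n ℓ) {u : ℕ} (hu : ¬ p ∣ u)
    {x : galoisCohomology (W.torsionGaloisModule ((p ^ n : ℕ) : ℤ)) 1}
    (hx : x ∈ kummerOutside W (p ^ n) {Sum.inr vℓ, Sum.inr vp})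
    (θ : W.kummerSelmerStructure ((p ^ n : ℕ) : ℤ) (Sum.inr vℓ) ≃+
      galoisCohomology ((W.torsionGaloisModule (p ^ n : ℕ)).toLocal (Sum.inr vℓ)) 1 ⧸
        W.kummerSelmerStructure ((p ^ n : ℕ) : ℤ) (Sum.inr vℓ))
    (hKS : (galoisCohomology.localization (W.torsionGaloisModule (p ^ n : ℕ)) (Sum.inr vℓ) 1 x :
        galoisCohomology ((W.torsionGaloisModule (p ^ n : ℕ)).toLocal (Sum.inr vℓ)) 1 ⧸
          W.kummerSelmerStructure ((p ^ n : ℕ) : ℤ) (Sum.inr vℓ)) =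
      θ ⟨_, X11b.Relaxation.localization_kummerMapTorsion_mem W (p ^ n) (Sum.inr vℓ) ((p ^ (m + F) * u) • P)⟩)
    (hout : n ≤ m + F + 2 * localDivExponent W p ℓ P)
    (hkim : ∀ ψp : galoisCohomology ((W.torsionGaloisModule (p ^ n : ℕ)).toLocal (Sum.inr vp)) 1 ⧸
        W.kummerSelmerStructure ((p ^ n : ℕ) : ℤ) (Sum.inr vp) ≃+ ZMod (p ^ n),
      (haveI : NeZero ℓ := ⟨(Fact.out : ℓ.Prime).ne_zero⟩
       zmodPowOrd p k (kuriharaNumber f (p ^ k) ℓ ψ)) =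
        min k (zmodPowOrd p n
          (ψp (galoisCohomology.localization (W.torsionGaloisModule (p ^ n : ℕ)) (Sum.inr vp) 1 x)))) :
    min k (n - m) ≤
      (haveI : NeZero ℓ := ⟨(Fact.out : ℓ.Prime).ne_zero⟩
       zmodPowOrd p k (kuriharaNumber f (p ^ k) ℓ ψ)) := by
  haveI : NeZero ℓ := ⟨(Fact.out : ℓ.Prime).ne_zero⟩
  rcases Nat.eq_zero_or_pos n with hn0 | hnpos
  · subst hn0; simp
  obtain ⟨ψ𝔭, hmin⟩ := exists_min_eq_min_of_kolyvaginClass W p ℓ P F m hp2 hgood hna hm1 hm2 hcycℓ hvℓ hvp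
    hPT hEPℓ hEPp hnpos hKP hu hx θ hKS
  rw [hkim ψ𝔭]
  generalize zmodPowOrd p n (ψ𝔭 (galoisCohomology.localization (W.torsionGaloisModule (p ^ n : ℕ))
    (Sum.inr vp) 1 x)) = s at hmin ⊢
  generalize localDivExponent W p ℓ P = v at hmin hout ⊢
  omega

end Law

/-! ### §3 The hypothesis «Kummer outside `{ℓ, p}`» in Mazur–Rubin's language: unramified at the good places -/

section Unramified

variable {K : Type} [Field K] [NumberField K] (W : WeierstrassCurve K) [W.IsElliptic] (n : ℕ) [NeZero n]

omit [NeZero n] in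
/-- **At a good finite place `v ∤ n` the Kummer condition IS the unramified condition**: for `x ∈ H¹(K, E[n])`,
`loc_v x ∈ 𝓛_v ⟺ x ∈ ker(H¹(K, E[n]) → H¹(I_𝔓, E[n]))` for any prime `𝔓` of `\bar ℤ_K` above `v` (the tree's
`selmerLocalKer_eq_unramifiedKer`, AEC VIII.§2 / X.4.1.1, with `comap_localization_kummerSelmerStructure`). So the
hypothesis `x ∈ kummerOutside W n {ℓ, p}` of the files above reads, at the good places `v ∤ n` off `{ℓ, p}`, «`x` is
unramified at `v`» — the condition `H¹_f = H¹_ur` of a Kolyvagin system for `(E[p^k], 𝓕_can, 𝒫)` (Mazur–Rubin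
Def. 3.2.1 / §6.2). [cite: SilvermanAEC2009, Remark X.4.1.1] [cite: MazurRubin2004, Def. 3.2.1] -/
theorem localization_mem_kummerSelmerStructure_iff_mem_unramifiedKer {v : HeightOneSpectrum (𝓞 K)}
    (hv : W.HasGoodReductionAt v) (hn : (n : 𝓞 K) ∉ v.asIdeal)
    {𝔓 : Ideal (absIntegers (𝓞 K) K)} (h𝔓 : 𝔓 ∈ v.primesAbove)
    (x : galoisCohomology (W.torsionGaloisModule (n : ℤ)) 1) :
    galoisCohomology.localization (W.torsionGaloisModule n) (Sum.inr v) 1 x ∈ W.kummerSelmerStructure n (Sum.inr v) ↔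
      x ∈ unramifiedKer (geomTorsion W n) 𝔓 := by
  have h1 : galoisCohomology.localization (W.torsionGaloisModule n) (Sum.inr v) 1 x ∈
      W.kummerSelmerStructure n (Sum.inr v) ↔ x ∈ selmerLocalKer W (v.adicCompletion K) (n : ℤ) :=
    SetLike.ext_iff.mp (W.comap_localization_kummerSelmerStructure (n : ℤ) (Sum.inr v)) x
  rw [h1, W.selmerLocalKer_eq_unramifiedKer hv (by exact_mod_cast hn) h𝔓]

omit [NeZero n] in
/-- **«Kummer outside `S`» from «unramified at the good places off `S`, Kummer at the others», for odd `n`**: if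
`x ∈ H¹(K, E[n])` is unramified at (some prime above) every good finite place `v ∤ n` outside `S` and satisfies the
Kummer condition at the remaining finite places outside `S`, then `x ∈ kummerOutside W n S` (the infinite places are
automatic for odd `n`, `ReciprocityPT.mem_kummerOutside_iff_finite_of_odd`). This is the form in which a Kolyvagin-system
class `κ_ℓ` for `𝓕_can` (unramified away from `pNℓ`, `H¹_f(K_v, T) ⊗` at `v ∣ N`, anything at `p`, transverse at
`ℓ`) meets the hypothesis of `zmodPowOrd_kuriharaNumber_eq_of_kolyvaginClass` with `S = {ℓ, p}`.
[cite: MazurRubin2004, Def. 3.2.1 and Thm. 3.2.4] -/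
theorem mem_kummerOutside_of_unramified_of_odd (hodd : Odd n) (S : Finset (Place K))
    (x : galoisCohomology (W.torsionGaloisModule (n : ℤ)) 1)
    (hgood : ∀ v : HeightOneSpectrum (𝓞 K), (Sum.inr v : Place K) ∉ S → W.HasGoodReductionAt v →
      (n : 𝓞 K) ∉ v.asIdeal → ∃ 𝔓 ∈ v.primesAbove, x ∈ unramifiedKer (geomTorsion W n) 𝔓)
    (hrest : ∀ v : HeightOneSpectrum (𝓞 K), (Sum.inr v : Place K) ∉ S →
      ¬ (W.HasGoodReductionAt v ∧ (n : 𝓞 K) ∉ v.asIdeal) →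
      galoisCohomology.localization (W.torsionGaloisModule n) (Sum.inr v) 1 x ∈ W.kummerSelmerStructure n (Sum.inr v)) :
    x ∈ kummerOutside W n S := by
  rw [ReciprocityPT.mem_kummerOutside_iff_finite_of_odd W n hodd S x]
  intro v hv
  by_cases h : W.HasGoodReductionAt v ∧ (n : 𝓞 K) ∉ v.asIdeal
  · obtain ⟨𝔓, h𝔓, hx⟩ := hgood v hv h.1 h.2
    exact (localization_mem_kummerSelmerStructure_iff_mem_unramifiedKer W n h.1 h.2 h𝔓 x).mpr hx
  · exact hrest v hv h

end Unramified

end Summit.BirchSwinnertonDyer.Rank1Residual.Ordinary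

end
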